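import Mathlib
/-! # Stub `stub_coneChart` — crux `TwoProducts` (stmt-ValiantsHypothesis-5906), line `corner-log-linearization`
   Corner localisation through the cone chart `L p = (⟨r₁,p⟩, ⟨r₂,p⟩)` (additive; injective as `det ≠ 0`):
   the LOCAL instance `u_j = Σ_{p ∈ supp f_j} (coeff p f_j / coeff μ_j f_j) X^{L p − L μ_j}` (exponents in `ℕ²`
   by adaptedness) is `t`-sparse with constant term `1`; expanding both products over words gives
   `coeff (Ψ e) (∏ u) = coeff e (∏ f) / ∏ coeff μ_j f_j` with `Ψ e = L e − L Σμ`.  If the corners `Σμ = Σν` and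
   the leading coefficients agree, `Ψ` charts sector vertices injectively onto south-west vertices of
   `∏ u − ∏ v`; otherwise every sector vertex is one of the two corners, whence `# ≤ # + 2`. [folklore] -/
set_option linter.dupNamespace false -- single-conjunct summit: `ValiantsHypothesis.ValiantsHypothesis`
namespace Summit.ValiantsHypothesis.ValiantsHypothesis.Theorems.TwoProducts.ConeChart
open scoped BigOperators
open MvPolynomial

-- adapted from Summits/ValiantsHypothesis/ValiantsHypothesis/Cruxes/DissociatedFixedK/FullProof-annihilator-product-functional.lean §E1
/-- Word expansion `∏_j f_j = Σ_{π ∈ Π_j supp f_j} X^{Σ_j π j} · ∏_j coeff (π j) f_j`. [folklore] -/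
theorem cc_prod_eq_sum_piFinset {m : ℕ} (f : Fin m → MvPolynomial (Fin 2) ℂ) :
    ∏ j, f j = ∑ π ∈ Fintype.piFinset (fun j => (f j).support),
      monomial (∑ j, π j) (∏ j, coeff (π j) (f j)) := by
  have : ∏ j, f j = ∏ j, ∑ e ∈ (f j).support, monomial e (coeff e (f j)) :=
    Finset.prod_congr rfl fun j _ => (f j).as_sum
  rw [this, Finset.prod_univ_sum]
  exact Finset.sum_congr rfl fun π _ => (monomial_sum_prod _ _ _).symm

/-- Every exponent of `∏_j f_j` is a word sum `Σ_j π j` with `π j ∈ supp f_j`. [folklore] -/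
theorem cc_exists_word_of_mem_support {m : ℕ} (f : Fin m → MvPolynomial (Fin 2) ℂ) (e : Fin 2 →₀ ℕ)
    (he : e ∈ (∏ j, f j).support) :
    ∃ π : Fin m → (Fin 2 →₀ ℕ), (∀ j, π j ∈ (f j).support) ∧ ∑ j, π j = e := by
  classical
  rw [cc_prod_eq_sum_piFinset f] at he
  obtain ⟨π, hπ, hmem⟩ := Finset.mem_biUnion.mp (support_sum he)
  exact ⟨π, Fintype.mem_piFinset.mp hπ, (Finset.mem_singleton.mp (support_monomial_subset hmem)).symm⟩

/-- A word other than the corner word weighs strictly more (additive weight `φ`). [folklore] -/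
theorem cc_word_lt {m : ℕ} (φ : (Fin 2 →₀ ℕ) →+ ℤ) (f : Fin m → MvPolynomial (Fin 2) ℂ)
    (μ : Fin m → (Fin 2 →₀ ℕ)) (hs : ∀ j, ∀ p ∈ (f j).support, p ≠ μ j → φ (μ j) < φ p)
    (π : Fin m → (Fin 2 →₀ ℕ)) (hπ : ∀ j, π j ∈ (f j).support) (hne : π ≠ μ) :
    φ (∑ j, μ j) < φ (∑ j, π j) := by
  obtain ⟨j₀, hj₀⟩ := Function.ne_iff.mp hne
  rw [map_sum, map_sum]
  refine Finset.sum_lt_sum (fun j _ => ?_) ⟨j₀, Finset.mem_univ _, hs j₀ _ (hπ j₀) hj₀⟩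
  rcases eq_or_ne (π j) (μ j) with hj | hj
  · rw [hj]
  · exact (hs j _ (hπ j) hj).le

/-- The coefficient of the corner `Σ_j μ_j` in `∏_j f_j` is `∏_j coeff μ_j f_j`. [folklore] -/
theorem cc_corner_coeff {m : ℕ} (φ : (Fin 2 →₀ ℕ) →+ ℤ) (f : Fin m → MvPolynomial (Fin 2) ℂ)
    (μ : Fin m → (Fin 2 →₀ ℕ)) (hs : ∀ j, ∀ p ∈ (f j).support, p ≠ μ j → φ (μ j) < φ p) :
    coeff (∑ j, μ j) (∏ j, f j) = ∏ j, coeff (μ j) (f j) := by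
  classical
  rw [cc_prod_eq_sum_piFinset f, coeff_sum, Finset.sum_eq_single μ]
  · rw [coeff_monomial, if_pos rfl]
  · intro π hπ hne
    rw [coeff_monomial, if_neg]
    exact fun h => (cc_word_lt φ f μ hs π (Fintype.mem_piFinset.mp hπ) hne).ne (by rw [h])
  · intro hμ
    rw [Fintype.mem_piFinset, not_forall] at hμ
    obtain ⟨j, hj⟩ := hμ
    rw [coeff_monomial, if_pos rfl]
    exact Finset.prod_eq_zero (Finset.mem_univ j) (notMem_support_iff.mp hj)

/-- The corner `Σ_j μ_j` weighs strictly less than every other exponent of `∏_j f_j`. [folklore] -/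
theorem cc_corner_lt {m : ℕ} (φ : (Fin 2 →₀ ℕ) →+ ℤ) (f : Fin m → MvPolynomial (Fin 2) ℂ)
    (μ : Fin m → (Fin 2 →₀ ℕ)) (hs : ∀ j, ∀ p ∈ (f j).support, p ≠ μ j → φ (μ j) < φ p)
    (e : Fin 2 →₀ ℕ) (he : e ∈ (∏ j, f j).support) (hne : e ≠ ∑ j, μ j) :
    φ (∑ j, μ j) < φ e := by
  obtain ⟨π, hπ, rfl⟩ := cc_exists_word_of_mem_support f e he
  exact cc_word_lt φ f μ hs π hπ fun h => hne (by rw [h])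

/-- Weak form: the corner weight bounds `supp ∏_j f_j` from below. [folklore] -/
theorem cc_corner_le {m : ℕ} (φ : (Fin 2 →₀ ℕ) →+ ℤ) (f : Fin m → MvPolynomial (Fin 2) ℂ)
    (μ : Fin m → (Fin 2 →₀ ℕ)) (hs : ∀ j, ∀ p ∈ (f j).support, p ≠ μ j → φ (μ j) < φ p)
    (e : Fin 2 →₀ ℕ) (he : e ∈ (∏ j, f j).support) : φ (∑ j, μ j) ≤ φ e := by
  rcases eq_or_ne e (∑ j, μ j) with hne | hne
  · rw [hne]
  · exact (cc_corner_lt φ f μ hs e he hne).le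

/-- Injectivity of the chart `p ↦ (⟨r₁,p⟩, ⟨r₂,p⟩)` when `det (r₁, r₂) ≠ 0`. [folklore] -/
theorem cc_chart_injective (r₁ r₂ : Fin 2 → ℤ) (hdet : r₁ 0 * r₂ 1 ≠ r₁ 1 * r₂ 0) (p q : Fin 2 →₀ ℕ)
    (h₁ : r₁ 0 * (p 0 : ℤ) + r₁ 1 * (p 1 : ℤ) = r₁ 0 * (q 0 : ℤ) + r₁ 1 * (q 1 : ℤ))
    (h₂ : r₂ 0 * (p 0 : ℤ) + r₂ 1 * (p 1 : ℤ) = r₂ 0 * (q 0 : ℤ) + r₂ 1 * (q 1 : ℤ)) : p = q := by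
  have hd : r₁ 0 * r₂ 1 - r₁ 1 * r₂ 0 ≠ 0 := sub_ne_zero.mpr hdet
  have e₀ : (r₁ 0 * r₂ 1 - r₁ 1 * r₂ 0) * ((p 0 : ℤ) - q 0) = 0 := by
    linear_combination (r₂ 1) * h₁ - (r₁ 1) * h₂
  have e₁ : (r₁ 0 * r₂ 1 - r₁ 1 * r₂ 0) * ((p 1 : ℤ) - q 1) = 0 := by
    linear_combination (r₁ 0) * h₂ - (r₂ 0) * h₁
  have h0 := sub_eq_zero.mp ((mul_eq_zero.mp e₀).resolve_left hd)
  have h1 := sub_eq_zero.mp ((mul_eq_zero.mp e₁).resolve_left hd)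
  ext i
  fin_cases i <;> assumption_mod_cast

/-- The chart is monotone along words: `L (Σ μ) ≤ L (Σ π)` if `L μ_j ≤ L π_j` for all `j`. [folklore] -/
theorem cc_chart_sum_le {m : ℕ} (L : (Fin 2 →₀ ℕ) →+ (Fin 2 → ℤ)) (μ π : Fin m → (Fin 2 →₀ ℕ))
    (h : ∀ j, L (μ j) ≤ L (π j)) : L (∑ j, μ j) ≤ L (∑ j, π j) := by
  intro i
  rw [map_sum, map_sum, Finset.sum_apply, Finset.sum_apply]
  exact Finset.sum_le_sum fun j _ => h j i

/-- On an adapted family every exponent of `∏ f` is charted above the corner. [folklore] -/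
theorem cc_le_chart_of_mem_support {m : ℕ} (L : (Fin 2 →₀ ℕ) →+ (Fin 2 → ℤ))
    (f : Fin m → MvPolynomial (Fin 2) ℂ) (μ : Fin m → (Fin 2 →₀ ℕ))
    (hA : ∀ j, ∀ p ∈ (f j).support, L (μ j) ≤ L p) (M : Fin 2 →₀ ℕ) (hM : ∑ j, μ j = M)
    (e : Fin 2 →₀ ℕ) (he : e ∈ (∏ j, f j).support) : L M ≤ L e := by
  obtain ⟨π, hπ, rfl⟩ := cc_exists_word_of_mem_support f e he
  subst hM
  exact cc_chart_sum_le L μ π fun j => hA j _ (hπ j)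

/-- Values of the chart `Ψ_M e = toNat (L e − L M)` above the corner. [folklore] -/
theorem cc_psi_apply (L : (Fin 2 →₀ ℕ) →+ (Fin 2 → ℤ)) (M e : Fin 2 →₀ ℕ) (h : L M ≤ L e) (i : Fin 2) :
    (((Finsupp.equivFunOnFinite.symm fun i => (L e i - L M i).toNat) i : ℕ) : ℤ) = L e i - L M i := by
  simp only [Finsupp.coe_equivFunOnFinite_symm]
  exact Int.toNat_of_nonneg (sub_nonneg.mpr (h i))

/-- The corner is charted to `0`. [folklore] -/
theorem cc_psi_self (L : (Fin 2 →₀ ℕ) →+ (Fin 2 → ℤ)) (M : Fin 2 →₀ ℕ) :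
    (Finsupp.equivFunOnFinite.symm fun i => (L M i - L M i).toNat) = 0 := by
  ext i; simp

/-- The chart `Ψ_M` is injective above the corner (through `L`). [folklore] -/
theorem cc_psi_inj (L : (Fin 2 →₀ ℕ) →+ (Fin 2 → ℤ)) (M p q : Fin 2 →₀ ℕ) (hp : L M ≤ L p)
    (hq : L M ≤ L q)
    (h : (Finsupp.equivFunOnFinite.symm fun i => (L p i - L M i).toNat) =
      Finsupp.equivFunOnFinite.symm fun i => (L q i - L M i).toNat) : L p = L q := by
  funext i
  have hi := congrArg (fun x : Fin 2 →₀ ℕ => ((x i : ℕ) : ℤ)) h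
  simp only [cc_psi_apply L M p hp i, cc_psi_apply L M q hq i] at hi
  linarith

/-- Additivity of the chart over adapted words: `Σ_j Ψ_{μ_j} (π j) = Ψ_{Σ μ} (Σ π)`. [folklore] -/
theorem cc_psi_sum {m : ℕ} (L : (Fin 2 →₀ ℕ) →+ (Fin 2 → ℤ)) (μ π : Fin m → (Fin 2 →₀ ℕ))
    (h : ∀ j, L (μ j) ≤ L (π j)) :
    ∑ j, (Finsupp.equivFunOnFinite.symm fun i => (L (π j) i - L (μ j) i).toNat) =
      Finsupp.equivFunOnFinite.symm fun i => (L (∑ j, π j) i - L (∑ j, μ j) i).toNat := by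
  have hle := cc_chart_sum_le L μ π h
  ext i
  have key : ((∑ j, (L (π j) i - L (μ j) i).toNat : ℕ) : ℤ) =
      (((L (∑ j, π j) i - L (∑ j, μ j) i).toNat : ℕ) : ℤ) := by
    rw [Int.toNat_of_nonneg (sub_nonneg.mpr (hle i)), map_sum, map_sum, Finset.sum_apply,
      Finset.sum_apply, ← Finset.sum_sub_distrib, Nat.cast_sum]
    exact Finset.sum_congr rfl fun j _ => Int.toNat_of_nonneg (sub_nonneg.mpr (h j i))
  rw [Finsupp.finsetSum_apply]
  simp only [Finsupp.coe_equivFunOnFinite_symm]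
  exact_mod_cast key

/-- Sparsity of a local factor: `|supp u| ≤ |supp f|`. [folklore] -/
theorem cc_local_card (L : (Fin 2 →₀ ℕ) →+ (Fin 2 → ℤ)) (φ : MvPolynomial (Fin 2) ℂ) (μ₀ : Fin 2 →₀ ℕ) :
    (∑ p ∈ φ.support, monomial (Finsupp.equivFunOnFinite.symm fun i => (L p i - L μ₀ i).toNat)
      (coeff p φ / coeff μ₀ φ)).support.card ≤ φ.support.card := by
  classical
  refine (Finset.card_le_card support_sum).trans (Finset.card_biUnion_le.trans ?_)
  rw [Finset.card_eq_sum_ones φ.support]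
  exact Finset.sum_le_sum fun p _ =>
    (Finset.card_le_card support_monomial_subset).trans (Finset.card_singleton _).le

/-- Constant term of a local factor: `coeff 0 u = 1`. [folklore] -/
theorem cc_local_coeff_zero (L : (Fin 2 →₀ ℕ) →+ (Fin 2 → ℤ)) (hL : Function.Injective L)
    (φ : MvPolynomial (Fin 2) ℂ) (μ₀ : Fin 2 →₀ ℕ) (hμ : μ₀ ∈ φ.support)
    (hA : ∀ p ∈ φ.support, L μ₀ ≤ L p) :
    coeff 0 (∑ p ∈ φ.support, monomial (Finsupp.equivFunOnFinite.symm fun i => (L p i - L μ₀ i).toNat)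
      (coeff p φ / coeff μ₀ φ)) = 1 := by
  classical
  rw [coeff_sum, Finset.sum_eq_single μ₀]
  · rw [coeff_monomial, if_pos (cc_psi_self L μ₀), div_self (mem_support_iff.mp hμ)]
  · intro p hp hne
    rw [coeff_monomial, if_neg]
    intro h0
    exact hne (hL (cc_psi_inj L μ₀ p μ₀ (hA p hp) le_rfl (h0.trans (cc_psi_self L μ₀).symm)))
  · exact fun h => absurd hμ h

/-- Word expansion of the local product `∏_j u_j`. [folklore] -/
theorem cc_prod_local_eq {m : ℕ} (L : (Fin 2 →₀ ℕ) →+ (Fin 2 → ℤ)) (f : Fin m → MvPolynomial (Fin 2) ℂ)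
    (μ : Fin m → (Fin 2 →₀ ℕ)) (u : Fin m → MvPolynomial (Fin 2) ℂ)
    (hu : ∀ j, u j = ∑ p ∈ (f j).support,
      monomial (Finsupp.equivFunOnFinite.symm fun i => (L p i - L (μ j) i).toNat)
        (coeff p (f j) / coeff (μ j) (f j))) :
    ∏ j, u j = ∑ π ∈ Fintype.piFinset (fun j => (f j).support),
      monomial (∑ j, Finsupp.equivFunOnFinite.symm fun i => (L (π j) i - L (μ j) i).toNat)
        (∏ j, (coeff (π j) (f j) / coeff (μ j) (f j))) := by
  simp only [hu]
  rw [Finset.prod_univ_sum]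
  exact Finset.sum_congr rfl fun π _ => (monomial_sum_prod _ _ _).symm

/-- Coefficient formula: `coeff (Ψ_M e) (∏ u) = coeff e (∏ f) / ∏_j coeff μ_j f_j` above the corner. [folklore] -/
theorem cc_prod_local_coeff {m : ℕ} (L : (Fin 2 →₀ ℕ) →+ (Fin 2 → ℤ)) (hL : Function.Injective L)
    (f : Fin m → MvPolynomial (Fin 2) ℂ) (μ : Fin m → (Fin 2 →₀ ℕ))
    (hA : ∀ j, ∀ p ∈ (f j).support, L (μ j) ≤ L p) (u : Fin m → MvPolynomial (Fin 2) ℂ)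
    (hu : ∀ j, u j = ∑ p ∈ (f j).support,
      monomial (Finsupp.equivFunOnFinite.symm fun i => (L p i - L (μ j) i).toNat)
        (coeff p (f j) / coeff (μ j) (f j)))
    (M : Fin 2 →₀ ℕ) (hM : ∑ j, μ j = M) (e : Fin 2 →₀ ℕ) (he : L M ≤ L e) :
    coeff (Finsupp.equivFunOnFinite.symm fun i => (L e i - L M i).toNat) (∏ j, u j) =
      coeff e (∏ j, f j) / ∏ j, coeff (μ j) (f j) := by
  classical
  subst hM
  rw [cc_prod_local_eq L f μ u hu, cc_prod_eq_sum_piFinset f, coeff_sum, coeff_sum, Finset.sum_div]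
  refine Finset.sum_congr rfl fun π hπ => ?_
  have hπ' : ∀ j, L (μ j) ≤ L (π j) := fun j => hA j _ (Fintype.mem_piFinset.mp hπ j)
  rw [coeff_monomial, coeff_monomial, cc_psi_sum L μ π hπ']
  by_cases hπe : ∑ j, π j = e
  · rw [if_pos hπe, if_pos (by rw [hπe]), Finset.prod_div_distrib]
  · rw [if_neg hπe, zero_div, if_neg]
    exact fun hΨ => hπe (hL (cc_psi_inj L _ _ _ (cc_chart_sum_le L μ π hπ') he hΨ))

/-- Support charting: every exponent of `∏ u` is `Ψ_M e` for some `e` charted above the corner. [folklore] -/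
theorem cc_prod_local_support {m : ℕ} (L : (Fin 2 →₀ ℕ) →+ (Fin 2 → ℤ))
    (f : Fin m → MvPolynomial (Fin 2) ℂ) (μ : Fin m → (Fin 2 →₀ ℕ))
    (hA : ∀ j, ∀ p ∈ (f j).support, L (μ j) ≤ L p) (u : Fin m → MvPolynomial (Fin 2) ℂ)
    (hu : ∀ j, u j = ∑ p ∈ (f j).support,
      monomial (Finsupp.equivFunOnFinite.symm fun i => (L p i - L (μ j) i).toNat)
        (coeff p (f j) / coeff (μ j) (f j)))
    (M : Fin 2 →₀ ℕ) (hM : ∑ j, μ j = M) (d : Fin 2 →₀ ℕ) (hd : d ∈ (∏ j, u j).support) :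
    ∃ e : Fin 2 →₀ ℕ, L M ≤ L e ∧ d = Finsupp.equivFunOnFinite.symm fun i => (L e i - L M i).toNat := by
  classical
  subst hM
  rw [cc_prod_local_eq L f μ u hu] at hd
  obtain ⟨π, hπ, hmem⟩ := Finset.mem_biUnion.mp (support_sum hd)
  have hπ' : ∀ j, L (μ j) ≤ L (π j) := fun j => hA j _ (Fintype.mem_piFinset.mp hπ j)
  refine ⟨∑ j, π j, cc_chart_sum_le L μ π hπ', ?_⟩
  rw [Finset.mem_singleton.mp (support_monomial_subset hmem), cc_psi_sum L μ π hπ']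

/-- **Cone chart (stub 4 of the line).**  For `t`-sparse factors and an adapted sector datum with nonempty
sector-vertex set, the local instance is `t`-sparse with constant terms `1` and
`#sectSet ≤ #swVertSet (∏ u − ∏ v) + 2`. [folklore] -/
theorem stub_coneChart : ∀ (m t : ℕ) (f g : Fin m → MvPolynomial (Fin 2) ℂ),
    (∀ j, (f j).support.card ≤ t) → (∀ j, (g j).support.card ≤ t) →
    ∀ (μ ν : Fin m → (Fin 2 →₀ ℕ)) (r₁ r₂ : Fin 2 → ℤ),
    (r₁ 0 * r₂ 1 ≠ r₁ 1 * r₂ 0 ∧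
      (∀ j, ∀ p ∈ (f j).support,
        r₁ 0 * ((μ j) 0 : ℤ) + r₁ 1 * ((μ j) 1 : ℤ) ≤ r₁ 0 * (p 0 : ℤ) + r₁ 1 * (p 1 : ℤ) ∧
        r₂ 0 * ((μ j) 0 : ℤ) + r₂ 1 * ((μ j) 1 : ℤ) ≤ r₂ 0 * (p 0 : ℤ) + r₂ 1 * (p 1 : ℤ)) ∧
      (∀ j, ∀ p ∈ (g j).support,
        r₁ 0 * ((ν j) 0 : ℤ) + r₁ 1 * ((ν j) 1 : ℤ) ≤ r₁ 0 * (p 0 : ℤ) + r₁ 1 * (p 1 : ℤ) ∧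
        r₂ 0 * ((ν j) 0 : ℤ) + r₂ 1 * ((ν j) 1 : ℤ) ≤ r₂ 0 * (p 0 : ℤ) + r₂ 1 * (p 1 : ℤ))) →
    {e : Fin 2 →₀ ℕ | ∃ a b : ℤ, 0 < a ∧ 0 < b ∧
        (∀ j, μ j ∈ (f j).support ∧ ∀ e' ∈ (f j).support, e' ≠ μ j →
          (a • r₁ + b • r₂) 0 * ((μ j) 0 : ℤ) + (a • r₁ + b • r₂) 1 * ((μ j) 1 : ℤ) <
            (a • r₁ + b • r₂) 0 * (e' 0 : ℤ) + (a • r₁ + b • r₂) 1 * (e' 1 : ℤ)) ∧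
        (∀ j, ν j ∈ (g j).support ∧ ∀ e' ∈ (g j).support, e' ≠ ν j →
          (a • r₁ + b • r₂) 0 * ((ν j) 0 : ℤ) + (a • r₁ + b • r₂) 1 * ((ν j) 1 : ℤ) <
            (a • r₁ + b • r₂) 0 * (e' 0 : ℤ) + (a • r₁ + b • r₂) 1 * (e' 1 : ℤ)) ∧
        (e ∈ (∏ j, f j - ∏ j, g j).support ∧ ∀ e' ∈ (∏ j, f j - ∏ j, g j).support, e' ≠ e →
          (a • r₁ + b • r₂) 0 * (e 0 : ℤ) + (a • r₁ + b • r₂) 1 * (e 1 : ℤ) <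
            (a • r₁ + b • r₂) 0 * (e' 0 : ℤ) + (a • r₁ + b • r₂) 1 * (e' 1 : ℤ))}.Nonempty →
    ∃ u v : Fin m → MvPolynomial (Fin 2) ℂ,
      (∀ i, (u i).support.card ≤ t) ∧ (∀ i, (v i).support.card ≤ t) ∧
      (∀ i, MvPolynomial.coeff 0 (u i) = 1) ∧ (∀ i, MvPolynomial.coeff 0 (v i) = 1) ∧
      {e : Fin 2 →₀ ℕ | ∃ a b : ℤ, 0 < a ∧ 0 < b ∧
        (∀ j, μ j ∈ (f j).support ∧ ∀ e' ∈ (f j).support, e' ≠ μ j →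
          (a • r₁ + b • r₂) 0 * ((μ j) 0 : ℤ) + (a • r₁ + b • r₂) 1 * ((μ j) 1 : ℤ) <
            (a • r₁ + b • r₂) 0 * (e' 0 : ℤ) + (a • r₁ + b • r₂) 1 * (e' 1 : ℤ)) ∧
        (∀ j, ν j ∈ (g j).support ∧ ∀ e' ∈ (g j).support, e' ≠ ν j →
          (a • r₁ + b • r₂) 0 * ((ν j) 0 : ℤ) + (a • r₁ + b • r₂) 1 * ((ν j) 1 : ℤ) <
            (a • r₁ + b • r₂) 0 * (e' 0 : ℤ) + (a • r₁ + b • r₂) 1 * (e' 1 : ℤ)) ∧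
        (e ∈ (∏ j, f j - ∏ j, g j).support ∧ ∀ e' ∈ (∏ j, f j - ∏ j, g j).support, e' ≠ e →
          (a • r₁ + b • r₂) 0 * (e 0 : ℤ) + (a • r₁ + b • r₂) 1 * (e 1 : ℤ) <
            (a • r₁ + b • r₂) 0 * (e' 0 : ℤ) + (a • r₁ + b • r₂) 1 * (e' 1 : ℤ))}.ncard ≤
      {e : Fin 2 →₀ ℕ | ∃ w : Fin 2 → ℤ, 0 < w 0 ∧ 0 < w 1 ∧ e ∈ (∏ i, u i - ∏ i, v i).support ∧
        ∀ e' ∈ (∏ i, u i - ∏ i, v i).support, e' ≠ e →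
          w 0 * (e 0 : ℤ) + w 1 * (e 1 : ℤ) < w 0 * (e' 0 : ℤ) + w 1 * (e' 1 : ℤ)}.ncard + 2 := by
  classical
  intro m t f g hf hg μ ν r₁ r₂ hAd hne
  obtain ⟨hdet, hAf, hAg⟩ := hAd
  have hμ : ∀ j, μ j ∈ (f j).support := by
    obtain ⟨_, _, _, _, _, hμ₀, -, -⟩ := hne
    exact fun j => (hμ₀ j).1
  have hν : ∀ j, ν j ∈ (g j).support := by
    obtain ⟨_, _, _, _, _, -, hν₀, -⟩ := hne
    exact fun j => (hν₀ j).1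
  -- the chart `L p = (⟨r₁,p⟩, ⟨r₂,p⟩)`
  obtain ⟨L, hL0, hL1⟩ : ∃ L : (Fin 2 →₀ ℕ) →+ (Fin 2 → ℤ),
      (∀ e, L e 0 = r₁ 0 * (e 0 : ℤ) + r₁ 1 * (e 1 : ℤ)) ∧
        ∀ e, L e 1 = r₂ 0 * (e 0 : ℤ) + r₂ 1 * (e 1 : ℤ) :=
    ⟨AddMonoidHom.mk' (fun (e : Fin 2 →₀ ℕ) (i : Fin 2) =>
        (![r₁, r₂] i) 0 * (e 0 : ℤ) + (![r₁, r₂] i) 1 * (e 1 : ℤ))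
      (fun p q => funext fun i => by simp only [Finsupp.coe_add, Pi.add_apply, Nat.cast_add]; ring),
      fun _ => rfl, fun _ => rfl⟩
  have hLinj : Function.Injective L := fun p q h =>
    cc_chart_injective r₁ r₂ hdet p q (by rw [← hL0, ← hL0, h]) (by rw [← hL1, ← hL1, h])
  have hAf' : ∀ j, ∀ p ∈ (f j).support, L (μ j) ≤ L p := fun j p hp => by
    rw [Pi.le_def, Fin.forall_fin_two, hL0, hL0, hL1, hL1]; exact hAf j p hp
  have hAg' : ∀ j, ∀ p ∈ (g j).support, L (ν j) ≤ L p := fun j p hp => by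
    rw [Pi.le_def, Fin.forall_fin_two, hL0, hL0, hL1, hL1]; exact hAg j p hp
  -- the local instance
  obtain ⟨u, hu⟩ : ∃ u : Fin m → MvPolynomial (Fin 2) ℂ, ∀ j, u j = ∑ p ∈ (f j).support,
      monomial (Finsupp.equivFunOnFinite.symm fun i => (L p i - L (μ j) i).toNat)
        (coeff p (f j) / coeff (μ j) (f j)) := ⟨_, fun _ => rfl⟩
  obtain ⟨v, hv⟩ : ∃ v : Fin m → MvPolynomial (Fin 2) ℂ, ∀ j, v j = ∑ p ∈ (g j).support,
      monomial (Finsupp.equivFunOnFinite.symm fun i => (L p i - L (ν j) i).toNat)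
        (coeff p (g j) / coeff (ν j) (g j)) := ⟨_, fun _ => rfl⟩
  refine ⟨u, v, fun i => (hu i) ▸ (cc_local_card L (f i) (μ i)).trans (hf i),
    fun i => (hv i) ▸ (cc_local_card L (g i) (ν i)).trans (hg i),
    fun i => (hu i) ▸ cc_local_coeff_zero L hLinj (f i) (μ i) (hμ i) (hAf' i),
    fun i => (hv i) ▸ cc_local_coeff_zero L hLinj (g i) (ν i) (hν i) (hAg' i), ?_⟩
  set F := ∏ j, f j - ∏ j, g j with hF
  set D := ∏ i, u i - ∏ i, v i with hD
  have hc : ∏ j, coeff (μ j) (f j) ≠ 0 := Finset.prod_ne_zero_iff.mpr fun j _ => mem_support_iff.mp (hμ j)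
  have hc' : ∏ j, coeff (ν j) (g j) ≠ 0 := Finset.prod_ne_zero_iff.mpr fun j _ => mem_support_iff.mp (hν j)
  by_cases hcase : ∑ j, μ j = ∑ j, ν j ∧ ∏ j, coeff (μ j) (f j) = ∏ j, coeff (ν j) (g j)
  · /- CASE A: corners and leading coefficients agree; chart the sector vertices by `Ψ`. -/
    obtain ⟨hMM, hcc⟩ := hcase
    have hcoefD : ∀ e, L (∑ j, μ j) ≤ L e →
        coeff (Finsupp.equivFunOnFinite.symm fun i => (L e i - L (∑ j, μ j) i).toNat) D =
          coeff e F / ∏ j, coeff (μ j) (f j) := by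
      intro e he
      rw [hD, hF, coeff_sub, coeff_sub, sub_div, cc_prod_local_coeff L hLinj f μ hAf' u hu _ rfl e he,
        cc_prod_local_coeff L hLinj g ν hAg' v hv _ hMM.symm e he, hcc]
    have hchart : ∀ d ∈ D.support, ∃ e, L (∑ j, μ j) ≤ L e ∧
        d = Finsupp.equivFunOnFinite.symm fun i => (L e i - L (∑ j, μ j) i).toNat := by
      intro d hd
      rcases Finset.mem_union.mp (support_sub _ _ _ hd) with h | h
      · exact cc_prod_local_support L f μ hAf' u hu _ rfl d h
      · exact cc_prod_local_support L g ν hAg' v hv _ hMM.symm d h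
    have hFle : ∀ e ∈ F.support, L (∑ j, μ j) ≤ L e := by
      intro e he
      rcases Finset.mem_union.mp (support_sub _ _ _ he) with h | h
      · exact cc_le_chart_of_mem_support L f μ hAf' _ rfl e h
      · exact cc_le_chart_of_mem_support L g ν hAg' _ hMM.symm e h
    refine (Set.ncard_le_ncard_of_injOn
      (fun e => Finsupp.equivFunOnFinite.symm fun i => (L e i - L (∑ j, μ j) i).toNat) ?_ ?_
      ((D.support.finite_toSet).subset fun d hd => ?_)).trans (Nat.le_add_right _ _)
    · -- `Ψ` maps sector vertices to south-west vertices of `D`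
      intro e he
      obtain ⟨a, b, ha, hb, -, -, heF, hemin⟩ := he
      have hW : ∀ x : Fin 2 →₀ ℕ, L (∑ j, μ j) ≤ L x →
          (![a, b] 0 * ((Finsupp.equivFunOnFinite.symm fun i => (L x i - L (∑ j, μ j) i).toNat) 0 : ℤ) +
            ![a, b] 1 * ((Finsupp.equivFunOnFinite.symm fun i => (L x i - L (∑ j, μ j) i).toNat) 1 : ℤ)) =
          ((a • r₁ + b • r₂) 0 * (x 0 : ℤ) + (a • r₁ + b • r₂) 1 * (x 1 : ℤ)) -
            ((a • r₁ + b • r₂) 0 * ((∑ j, μ j) 0 : ℤ) + (a • r₁ + b • r₂) 1 * ((∑ j, μ j) 1 : ℤ)) := by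
        intro x hx
        rw [cc_psi_apply L _ x hx 0, cc_psi_apply L _ x hx 1, hL0, hL0, hL1, hL1]
        simp only [Matrix.cons_val_zero, Matrix.cons_val_one, Matrix.cons_val_fin_one, Pi.add_apply,
          Pi.smul_apply, smul_eq_mul]
        ring
      refine ⟨![a, b], by simpa using ha, by simpa using hb, ?_, ?_⟩
      · rw [mem_support_iff, hcoefD e (hFle e heF)]
        exact div_ne_zero (mem_support_iff.mp heF) hc
      · intro d hd hne
        obtain ⟨e₁, he₁, rfl⟩ := hchart d hd
        have he₁F : e₁ ∈ F.support := by
          rw [mem_support_iff, hcoefD e₁ he₁] at hd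
          exact mem_support_iff.mpr fun h0 => hd (by rw [h0, zero_div])
        have hlt := hemin e₁ he₁F fun h => hne (by rw [h])
        rw [hW e (hFle e heF), hW e₁ he₁]
        linarith
    · -- `Ψ` is injective on sector vertices
      intro e₁ h₁ e₂ h₂ hΨ
      obtain ⟨-, -, -, -, -, -, h₁F, -⟩ := h₁
      obtain ⟨-, -, -, -, -, -, h₂F, -⟩ := h₂
      exact hLinj (cc_psi_inj L _ e₁ e₂ (hFle e₁ h₁F) (hFle e₂ h₂F) hΨ)
    · obtain ⟨_, -, -, hd, -⟩ := hd -- finiteness: south-west vertices lie in `supp D`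
      exact hd
  · /- CASE B: every sector vertex is one of the two product corners. -/
    refine (Set.ncard_le_ncard (t := ({∑ j, μ j, ∑ j, ν j} : Set (Fin 2 →₀ ℕ))) ?_).trans
      (((Set.ncard_insert_le _ _).trans (by rw [Set.ncard_singleton])).trans (Nat.le_add_left _ _))
    intro e he
    obtain ⟨a, b, -, -, hμs, hνs, heF, hemin⟩ := he
    -- the sector weight as an additive functional
    obtain ⟨φ, hφ⟩ : ∃ φ : (Fin 2 →₀ ℕ) →+ ℤ,
        ∀ x, φ x = (a • r₁ + b • r₂) 0 * (x 0 : ℤ) + (a • r₁ + b • r₂) 1 * (x 1 : ℤ) :=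
      ⟨AddMonoidHom.mk' (fun x : Fin 2 →₀ ℕ => (a • r₁ + b • r₂) 0 * (x 0 : ℤ) + (a • r₁ + b • r₂) 1 * (x 1 : ℤ))
        (fun p q => by simp only [Finsupp.coe_add, Pi.add_apply, Nat.cast_add]; ring), fun _ => rfl⟩
    have hsf : ∀ j, ∀ p ∈ (f j).support, p ≠ μ j → φ (μ j) < φ p :=
      fun j p hp hne => by rw [hφ, hφ]; exact (hμs j).2 p hp hne
    have hsg : ∀ j, ∀ p ∈ (g j).support, p ≠ ν j → φ (ν j) < φ p :=
      fun j p hp hne => by rw [hφ, hφ]; exact (hνs j).2 p hp hne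
    have hemin' : ∀ e' ∈ F.support, e' ≠ e → φ e < φ e' :=
      fun e' he' hne => by rw [hφ, hφ]; exact hemin e' he' hne
    have hcf := cc_corner_coeff φ f μ hsf
    have hcg := cc_corner_coeff φ g ν hsg
    -- every exponent of `F` weighs at least one of the two corners
    have hlow : ∀ x ∈ F.support, φ (∑ j, μ j) ≤ φ x ∨ φ (∑ j, ν j) ≤ φ x := by
      intro x hx
      rcases Finset.mem_union.mp (support_sub _ _ _ hx) with h | h
      · exact Or.inl (cc_corner_le φ f μ hsf x h)
      · exact Or.inr (cc_corner_le φ g ν hsg x h)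
    -- a corner of minimal weight survives in `F`
    obtain ⟨m₀, hm₀, hm₀F, hm₀M, hm₀M'⟩ : ∃ m₀, (m₀ = ∑ j, μ j ∨ m₀ = ∑ j, ν j) ∧ m₀ ∈ F.support ∧
        φ m₀ ≤ φ (∑ j, μ j) ∧ φ m₀ ≤ φ (∑ j, ν j) := by
      rcases le_or_gt (φ (∑ j, μ j)) (φ (∑ j, ν j)) with hle | hlt
      · refine ⟨∑ j, μ j, Or.inl rfl, ?_, le_rfl, hle⟩
        rw [mem_support_iff, hF, coeff_sub, hcf]
        by_cases hMg : ∑ j, μ j ∈ (∏ j, g j).support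
        · have hMM : ∑ j, μ j = ∑ j, ν j :=
            by_contra fun hne => (not_lt.mpr hle) (cc_corner_lt φ g ν hsg _ hMg hne)
          rw [hMM, hcg]
          exact sub_ne_zero.mpr fun h => hcase ⟨hMM, h⟩
        · rw [notMem_support_iff.mp hMg, sub_zero]; exact hc
      · refine ⟨∑ j, ν j, Or.inr rfl, ?_, hlt.le, le_rfl⟩
        have hM'f : ∑ j, ν j ∉ (∏ j, f j).support := fun hin =>
          (not_le.mpr hlt) (cc_corner_le φ f μ hsf _ hin)
        rw [mem_support_iff, hF, coeff_sub, hcg, notMem_support_iff.mp hM'f, zero_sub, neg_ne_zero]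
        exact hc'
    have hem : e = m₀ := by
      by_contra hne
      have h1 : φ e < φ m₀ := hemin' m₀ hm₀F (Ne.symm hne)
      rcases hlow e heF with h | h <;> linarith
    rw [hem]
    exact hm₀

end Summit.ValiantsHypothesis.ValiantsHypothesis.Theorems.TwoProducts.ConeChart
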